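import Summits.HodgeConjecture.HodgeConjecture.Theses.ELineTransport
import Summits.HodgeConjecture.HodgeConjecture.Theorems.CurveNetMordellWeilComplexOrientationExists

/-!
# Route ELineTransport — `IsogenyInvarianceOfPieces` (glue item stmt-HodgeConjecture-17599)

`SquareHodgeOfEClass → EClassOfSquareHodge → EClassTransport → IsogenyInvariance`: for the isogenous
pair `(S₀, J₀)`, `(S₁, J₁)` of `IsogenyInvariance`, the Hodge conjecture for `S₀ × S₀` yields an
algebraic class `γ₀` inducing `J₀` (`EClassOfSquareHodge`), which is transported to `S₁`
(`EClassTransport`) and gives the Hodge conjecture for `S₁ × S₁` (`SquareHodgeOfEClass`).  Two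
book-keeping points: (1) the three pieces are stated for an orientation family with Poincaré duality,
which EXISTS (`complexOrientationExists_proof`, route `CurveNetMordellWeil`, proved); (2)
`IsogenyInvariance` records for `J₀` only its `(2,0)`-eigenvalue, the other three structure properties
(rationality, `J₀² = m`, self-adjointness for the cup product) being those of `J₁` transported along
the given isometry `g` (`g ∘ J₁ = J₀ ∘ g`, `g₄ (a ∪ b) = g a ∪ g b`) — a few lines of linear algebra
below.  No named-fact hypothesis, no sorry.
-/

-- `Summit.HodgeConjecture.HodgeConjecture.Theorems` is the mandated namespace (single-problem
-- summit: Problem = Summit), which `linter.dupNamespace` flags on every declaration; the lakefile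
-- turns the linter off tree-wide (weak option), restated here so stand-alone elaboration is
-- warning-free too.
set_option linter.dupNamespace false

namespace Summit.HodgeConjecture.HodgeConjecture.Theorems

open Literature.AlgebraicGeometry.Motives Literature.AlgebraicGeometry.HodgeTheory
  Literature.AlgebraicTopology.SingularHomology

/-- **Item stmt-HodgeConjecture-17599 (`IsogenyInvarianceOfPieces`), route `ELineTransport`**:
`IsogenyInvariance` from the three pieces — orientation family from `complexOrientationExists_proof`,
the full `E`-structure of `J₀` transported from `J₁` along the isometry `g`, then
`EClassOfSquareHodge`, `EClassTransport`, `SquareHodgeOfEClass` in turn. [cite: Buskin2019, Thm. 1.1] -/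
theorem eLineTransport_isogenyInvarianceOfPieces_proof :
    Summit.HodgeConjecture.HodgeConjecture.Theses.ELineTransport.IsogenyInvarianceOfPieces := by
  intro hSq hE hT S₀ S₁ hS₀ hS₁ m hm J₀ J₁ hJ₀ hJ₁ hrank hg hHC₀ hψ₁ hv₁
  obtain ⟨μ, hμ⟩ := complexOrientationExists_proof
  obtain ⟨g, g₄, hgr, hgJ, hgc, -⟩ := id hg
  -- `J₀ = g ∘ J₁ ∘ g⁻¹`
  have hJ₀g : ∀ c, J₀ c = g (J₁ (g.symm c)) := fun c ↦ by
    have h := hgJ (g.symm c)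
    rw [LinearEquiv.apply_symm_apply] at h
    exact h.symm
  -- the full `E`-structure of `J₀`, transported from `J₁`
  have hJ₀full : (∀ c, IsRationalClass c → IsRationalClass (J₀ c)) ∧
      (∀ c, J₀ (J₀ c) = (m : ℂ) • c) ∧
      (∀ a b, cupProduct rfl (J₀ a) b = cupProduct rfl a (J₀ b)) ∧
      (∀ c, IsOfHodgeType 2 S₀ 2 2 0 c → J₀ c = (Real.sqrt m : ℂ) • c) := by
    refine ⟨fun c hc ↦ ?_, fun c ↦ ?_, fun a b ↦ ?_, hJ₀⟩
    · rw [hJ₀g]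
      refine (hgr _).1 (hJ₁.1 _ ?_)
      rw [hgr, LinearEquiv.apply_symm_apply]
      exact hc
    · rw [hJ₀g (J₀ c), hJ₀g c, LinearEquiv.symm_apply_apply, hJ₁.2.1, map_smul,
        LinearEquiv.apply_symm_apply]
    · calc cupProduct rfl (J₀ a) b
          = cupProduct rfl (g (J₁ (g.symm a))) (g (g.symm b)) := by
            rw [← hJ₀g, LinearEquiv.apply_symm_apply]
        _ = g₄ (cupProduct rfl (J₁ (g.symm a)) (g.symm b)) := (hgc _ _).symm
        _ = g₄ (cupProduct rfl (g.symm a) (J₁ (g.symm b))) := by rw [hJ₁.2.2.1]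
        _ = cupProduct rfl (g (g.symm a)) (g (J₁ (g.symm b))) := hgc _ _
        _ = cupProduct rfl a (J₀ b) := by rw [LinearEquiv.apply_symm_apply, ← hJ₀g]
  -- the three pieces in turn
  obtain ⟨γ₀, hγ₀, hJγ₀⟩ := hE μ hμ S₀ hS₀ m hm J₀ hJ₀full hHC₀
  obtain ⟨γ₁, hγ₁, hJγ₁⟩ :=
    hT μ hμ S₀ S₁ hS₀ hS₁ m hm J₀ J₁ hJ₀full hJ₁ hrank hg hv₁ ⟨γ₀, hγ₀, hJγ₀⟩
  exact hSq μ hμ S₁ hS₁ m hm J₁ hJ₁ hψ₁ ⟨γ₁, hγ₁, hJγ₁⟩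

end Summit.HodgeConjecture.HodgeConjecture.Theorems
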